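import Literature.AnabelianGeometry.AbsoluteAnabelian.LocalUnramifiedValuation
import Literature.NumberTheory.GaloisRepresentations.KummerSES
import HarnessLib

/-!
# The normalised `ℚ`-valued valuation `ord : F̄ˣ → ℚ` of a nonarchimedean local field

Topic `NumberTheory/GaloisRepresentations`; namespace
`Literature.NumberTheory.GaloisRepresentations.IsNonarchimedeanLocalField`.  Definitions with bodies and theorems;
no named fact, no instance, no `sorry`.

For a nonarchimedean local field `F` with absolute value `‖·‖` extended to `F̄` (the tree's `algNorm F`, Mathlib's
spectral norm; unique, multiplicative, `Γ_F`-invariant), every `x ∈ F̄ˣ` has `‖x‖ = ‖ϖ_F‖ ^ r` for a unique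
RATIONAL `r = ord x = v_F(N_{F(x)/F} x) / [F(x) : F]` (`spectralNorm_eq_norm_coeff_zero_rpow` and `‖Fˣ‖ = ‖ϖ_F‖^ℤ`).
We define the additive `Γ_F`-invariant homomorphism `ordQ F : F̄ˣ → ℚ` (on the carrier `UnitsCarrier F` of the Galois
module `units F`), normalised by `ordQ ϖ = 1` for every uniformiser `ϖ` of `F`, integral (`= unrOrd`) on the maximal
unramified extension `F^nr`, and vanishing exactly on the units `‖x‖ = 1` of `𝒪_{F̄}`.  This is the `ordQ` input of
`HomDual.exists_unitValued_dualδ₀_eq` (door-c6 g16 presentation road, unit-valued refinement `F5`).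

References: Neukirch, *Algebraic Number Theory* II (4.8) (unique extension `|x| = |N x|^{1/n}`), II (6.2);
Serre, *Local Fields* II §2–§3, III §5.
-/

noncomputable section

namespace Literature.NumberTheory.GaloisRepresentations

namespace IsNonarchimedeanLocalField

open Function Field ValuativeRel IntermediateField DiscreteGaloisModule
open Literature.AnabelianGeometry.AbsoluteAnabelian

universe u

variable (F : Type u) [Field F] [ValuativeRel F] [TopologicalSpace F] [IsNonarchimedeanLocalField F]

/-! ## §1 `‖F̄ˣ‖ = ‖ϖ_F‖ ^ ℚ` -/

/-- The absolute value `‖ϖ_F‖ ∈ (0, 1)` of (any) uniformiser of `F`, the base of the valuation.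
[cite: SerreLocalFields1979, II §3] -/
def uniformizerNorm : ℝ :=
  algNorm F (algebraMap 𝒪[F] (AlgebraicClosure F) (unrUniformizer F))

/-- `0 < ‖ϖ_F‖`. [cite: SerreLocalFields1979, II §3] -/
theorem uniformizerNorm_pos : 0 < uniformizerNorm F := algNorm_uniformizer_pos (irreducible_unrUniformizer F)

/-- `‖ϖ_F‖ < 1`. [cite: SerreLocalFields1979, II §3] -/
theorem uniformizerNorm_lt_one : uniformizerNorm F < 1 := algNorm_uniformizer_lt_one (irreducible_unrUniformizer F)

/-- `r ↦ ‖ϖ_F‖ ^ r` is injective on `ℚ`. [cite: SerreLocalFields1979, II §3] -/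
theorem uniformizerNorm_rpow_injective : Injective fun r : ℚ => uniformizerNorm F ^ (r : ℝ) := fun _ _ h =>
  Rat.cast_injective (α := ℝ)
    ((Real.strictAnti_rpow_of_base_lt_one (uniformizerNorm_pos F) (uniformizerNorm_lt_one F)).injective h)

/-- **`‖x‖ ∈ ‖ϖ_F‖ ^ ℚ` for `x ∈ F̄ˣ`**: `‖x‖ = ‖a₀‖ ^ {1/d}` for the constant coefficient `a₀ ∈ Fˣ` and the degree
`d` of the minimal polynomial of `x` (Mathlib `spectralNorm_eq_norm_coeff_zero_rpow`), and `‖a₀‖ = ‖ϖ_F‖ ^ n`.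
[cite: NeukirchANT1999, Ch. II (4.8)] -/
theorem exists_algNorm_eq_rpow {x : AlgebraicClosure F} (hx : x ≠ 0) :
    ∃ r : ℚ, algNorm F x = uniformizerNorm F ^ (r : ℝ) := by
  letI := nontriviallyNormedField F
  have hint : IsIntegral F x := Algebra.IsIntegral.isIntegral x
  set a₀ : F := (minpoly F x).coeff 0 with ha₀def
  have ha₀ : a₀ ≠ 0 := minpoly.coeff_zero_ne_zero hint hx
  have hmem : algebraMap F (AlgebraicClosure F) a₀ ∈ maxUnramified F := IntermediateField.algebraMap_mem _ _
  have hne : algebraMap F (AlgebraicClosure F) a₀ ≠ 0 := by rwa [map_ne_zero]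
  obtain ⟨n, hn⟩ := exists_algNorm_eq_zpow_of_mem_maxUnramified (irreducible_unrUniformizer F) hmem hne
  refine ⟨(n : ℚ) / ((minpoly F x).natDegree : ℚ), ?_⟩
  have hformula := spectralNorm.spectralNorm_eq_norm_coeff_zero_rpow F (AlgebraicClosure F) x
  rw [algNorm_def, hformula, ← ha₀def, ← algNorm_algebraMap, hn]
  change (uniformizerNorm F ^ n) ^ (1 / ((minpoly F x).natDegree : ℝ)) = _
  rw [← Real.rpow_intCast, ← Real.rpow_mul (uniformizerNorm_pos F).le]
  congr 1
  push_cast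
  ring

/-! ## §2 The homomorphism `ordQ : F̄ˣ → ℚ` -/

/-- The exponent of a unit: the rational `r` with `‖u‖ = ‖ϖ_F‖ ^ r`. [cite: NeukirchANT1999, Ch. II (4.8)] -/
def ordQFun (u : UnitsCarrier F) : ℚ :=
  Classical.choose (exists_algNorm_eq_rpow F (Units.ne_zero (unitsVal F u)))

/-- `‖u‖ = ‖ϖ_F‖ ^ (ordQFun u)`. [cite: NeukirchANT1999, Ch. II (4.8)] -/
theorem algNorm_eq_rpow_ordQFun (u : UnitsCarrier F) :
    algNorm F (unitsVal F u : AlgebraicClosure F) = uniformizerNorm F ^ (ordQFun F u : ℝ) :=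
  Classical.choose_spec (exists_algNorm_eq_rpow F (Units.ne_zero (unitsVal F u)))

/-- `ordQFun u` is characterised by `‖u‖ = ‖ϖ_F‖ ^ r`. [cite: NeukirchANT1999, Ch. II (4.8)] -/
theorem ordQFun_eq_of_algNorm_eq {u : UnitsCarrier F} {r : ℚ}
    (h : algNorm F (unitsVal F u : AlgebraicClosure F) = uniformizerNorm F ^ (r : ℝ)) : ordQFun F u = r :=
  uniformizerNorm_rpow_injective F ((algNorm_eq_rpow_ordQFun F u).symm.trans h)

/-- **The normalised valuation `ord : F̄ˣ → ℚ`** (`‖x‖ = ‖ϖ_F‖ ^ {ord x}`), an additive homomorphism on the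
carrier of the Galois module `K̄ˣ = units F`. [cite: NeukirchANT1999, Ch. II (4.8)] [cite: SerreLocalFields1979, II §2] -/
def ordQ : UnitsCarrier F →+ ℚ where
  toFun := ordQFun F
  map_zero' := ordQFun_eq_of_algNorm_eq F (by
    rw [Rat.cast_zero, Real.rpow_zero]
    change algNorm F ((unitsVal F 0 : (AlgebraicClosure F)ˣ) : AlgebraicClosure F) = 1
    rw [show unitsVal F 0 = 1 from rfl, Units.val_one, algNorm_one])
  map_add' u u' := ordQFun_eq_of_algNorm_eq F (by
    rw [unitsVal_add, Units.val_mul, algNorm_mul, algNorm_eq_rpow_ordQFun, algNorm_eq_rpow_ordQFun,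
      Rat.cast_add, Real.rpow_add (uniformizerNorm_pos F)])

/-- `‖u‖ = ‖ϖ_F‖ ^ (ordQ u)`. [cite: NeukirchANT1999, Ch. II (4.8)] -/
theorem algNorm_eq_rpow_ordQ (u : UnitsCarrier F) :
    algNorm F (unitsVal F u : AlgebraicClosure F) = uniformizerNorm F ^ (ordQ F u : ℝ) :=
  algNorm_eq_rpow_ordQFun F u

/-- `ordQ u` is characterised by `‖u‖ = ‖ϖ_F‖ ^ r`. [cite: NeukirchANT1999, Ch. II (4.8)] -/
theorem ordQ_eq_of_algNorm_eq {u : UnitsCarrier F} {r : ℚ}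
    (h : algNorm F (unitsVal F u : AlgebraicClosure F) = uniformizerNorm F ^ (r : ℝ)) : ordQ F u = r :=
  ordQFun_eq_of_algNorm_eq F h

/-- **`ord` is `Γ_F`-invariant**: `ord (σ u) = ord u` (`Γ_F` acts on `F̄` by isometries).
[cite: NeukirchANT1999, Ch. II (4.8)] -/
theorem ordQ_smul (σ : absoluteGaloisGroup F) (u : UnitsCarrier F) : ordQ F (units F σ u) = ordQ F u :=
  ordQ_eq_of_algNorm_eq F (by rw [unitsVal_apply, Units.coe_smul, algNorm_smul, algNorm_eq_rpow_ordQ])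

/-- **`ord u = 0 ↔ ‖u‖ = 1`** (the kernel of `ord` is the unit group of `𝒪_{F̄}`). [cite: SerreLocalFields1979, II §2] -/
theorem ordQ_eq_zero_iff (u : UnitsCarrier F) :
    ordQ F u = 0 ↔ algNorm F (unitsVal F u : AlgebraicClosure F) = 1 := by
  constructor
  · intro h
    rw [algNorm_eq_rpow_ordQ, h, Rat.cast_zero, Real.rpow_zero]
  · intro h
    exact ordQ_eq_of_algNorm_eq F (by rw [h, Rat.cast_zero, Real.rpow_zero])

/-! ## §3 Integrality on `F^nr` and the normalisation `ord ϖ = 1` -/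

/-- **On `F^nr` the valuation is the integer `unrOrd`** (`F^nr/F` is unramified: `‖F^nrˣ‖ = ‖ϖ_F‖^ℤ`).
[cite: SerreLocalFields1979, III §5 Thm. 2] -/
theorem ordQ_eq_unrOrd {u : UnitsCarrier F} (hu : (unitsVal F u : AlgebraicClosure F) ∈ maxUnramified F) :
    ordQ F u = unrOrd F (unitsVal F u : AlgebraicClosure F) :=
  ordQ_eq_of_algNorm_eq F (by
    rw [Rat.cast_intCast, Real.rpow_intCast]
    exact algNorm_eq_zpow_unrOrd F hu (Units.ne_zero _))

/-- `ord u ∈ ℤ` for `u ∈ F^nrˣ` (the integrality input `hint` of `HomDual.exists_unitValued_dualδ₀_eq`).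
[cite: SerreLocalFields1979, III §5 Thm. 2] -/
theorem exists_int_cast_eq_ordQ {u : UnitsCarrier F} (hu : (unitsVal F u : AlgebraicClosure F) ∈ maxUnramified F) :
    ∃ m : ℤ, (m : ℚ) = ordQ F u :=
  ⟨unrOrd F (unitsVal F u : AlgebraicClosure F), (ordQ_eq_unrOrd F hu).symm⟩

omit [ValuativeRel F] [TopologicalSpace F] [IsNonarchimedeanLocalField F] in
/-- A non-zero element `a ∈ F` as an element of the carrier `F̄ˣ`. [cite: SerreLocalFields1979, II §2] -/
def unitOfBase (a : F) (ha : a ≠ 0) : UnitsCarrier F :=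
  UnitsCarrier.ofUnits (Units.mk0 (algebraMap F (AlgebraicClosure F) a) (by rwa [map_ne_zero]))

omit [ValuativeRel F] [TopologicalSpace F] [IsNonarchimedeanLocalField F] in
/-- Unfolding `unitOfBase`. [cite: SerreLocalFields1979, II §2] -/
@[simp] theorem unitsVal_unitOfBase (a : F) (ha : a ≠ 0) :
    (unitsVal F (unitOfBase F a ha) : AlgebraicClosure F) = algebraMap F (AlgebraicClosure F) a := rfl

omit [ValuativeRel F] [TopologicalSpace F] [IsNonarchimedeanLocalField F] in
/-- **Elements of `F` are fixed by `Γ_F`** (in the carrier `F̄ˣ`): the input `hϖΓ` of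
`HomDual.exists_unitValued_dualδ₀_eq`. [cite: SerreLocalFields1979, II §2] -/
theorem units_unitOfBase (σ : absoluteGaloisGroup F) (a : F) (ha : a ≠ 0) :
    units F σ (unitOfBase F a ha) = unitOfBase F a ha := by
  apply unitsVal_injective F
  apply Units.ext
  rw [unitsVal_apply, Units.coe_smul, unitsVal_unitOfBase, absoluteGaloisGroup.smul_def, AlgEquiv.commutes]

/-- Elements of `Fˣ` have integral valuation. [cite: SerreLocalFields1979, II §2] -/
theorem exists_int_cast_eq_ordQ_unitOfBase (a : F) (ha : a ≠ 0) : ∃ m : ℤ, (m : ℚ) = ordQ F (unitOfBase F a ha) :=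
  exists_int_cast_eq_ordQ F (by rw [unitsVal_unitOfBase]; exact IntermediateField.algebraMap_mem _ _)

/-- **`ord ϖ = 1` for every uniformiser `ϖ` of `F`** (the normalisation; input `hϖ` of
`HomDual.exists_unitValued_dualδ₀_eq`). [cite: SerreLocalFields1979, II §3] -/
theorem ordQ_uniformizer {ϖ : 𝒪[F]} (hϖ : Irreducible ϖ) :
    ordQ F (unitOfBase F (ϖ : F) (by
      intro h
      exact hϖ.ne_zero (Subtype.val_injective (by simpa using h)))) = 1 := by
  have hmem : algebraMap 𝒪[F] (AlgebraicClosure F) ϖ ∈ maxUnramified F := by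
    rw [IsScalarTower.algebraMap_apply 𝒪[F] F (AlgebraicClosure F)]
    exact IntermediateField.algebraMap_mem _ _
  have hval : (unitsVal F (unitOfBase F (ϖ : F) (by
      intro h
      exact hϖ.ne_zero (Subtype.val_injective (by simpa using h)))) : AlgebraicClosure F) =
      algebraMap 𝒪[F] (AlgebraicClosure F) ϖ := by
    rw [unitsVal_unitOfBase, IsScalarTower.algebraMap_apply 𝒪[F] F (AlgebraicClosure F)]
    rfl
  rw [ordQ_eq_unrOrd F (by rw [hval]; exact hmem), hval, unrOrd_algebraMap_eq_one F hϖ, Int.cast_one]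

/-- There is a uniformiser: an element `ϖ ∈ F̄ˣ` coming from `F`, fixed by `Γ_F`, with `ord ϖ = 1`.
[cite: SerreLocalFields1979, II §3] -/
theorem exists_ordQ_eq_one : ∃ ϖ : UnitsCarrier F, (∀ σ : absoluteGaloisGroup F, units F σ ϖ = ϖ) ∧ ordQ F ϖ = 1 :=
  ⟨_, fun σ => units_unitOfBase F σ _ _, ordQ_uniformizer F (irreducible_unrUniformizer F)⟩

/-- `n`-torsion elements have valuation `0` (roots of unity are units). [cite: SerreLocalFields1979, II §2] -/
theorem ordQ_eq_zero_of_nsmul_eq_zero {n : ℕ} (hn : n ≠ 0) {u : UnitsCarrier F} (hu : n • u = 0) : ordQ F u = 0 := by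
  have h : (n : ℚ) * ordQ F u = 0 := by rw [← nsmul_eq_mul, ← map_nsmul, hu, map_zero]
  rcases mul_eq_zero.1 h with h | h
  · exact absurd (by exact_mod_cast h) hn
  · exact h

end IsNonarchimedeanLocalField

end Literature.NumberTheory.GaloisRepresentations

end
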